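import Mathlib
import HarnessLib
import Literature.MathematicalPhysics.KineticTheory.HardSphereEulerProofs
import Literature.Analysis.FluidPDE.CollisionalTransfer
import Summits.AtomisticToContinuum.HydrodynamicLimit.Theses.OneFlightGossipEngine
import Summits.AtomisticToContinuum.HydrodynamicLimit.Theorems.OneFlightGossipEngineKineticCurrentsWindowLDUniformWindowRenyiOfTransportPrelim
import Summits.AtomisticToContinuum.HydrodynamicLimit.Theorems.OneFlightGossipEngineEquilibriumClampedCollisionalWindowLDRadialVirialTemplate

/-!
# Rényi quasi-invariance along a profile family FROM family kinetic-window transport tightness —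
# stub `stub_windowRenyiFamily_of_transport` of line `Sketch`, crux `KineticCurrentsLDAlongFamilies`
# (stmt-AtomisticToContinuum-16659)

Route `OneFlightGossipEngine`, sub-problem `HydrodynamicLimit`. Helper toward the registered open stub S2
`stub_windowRenyiFamily` of the skeleton `Cruxes/KineticCurrentsLDAlongFamilies/Lines/Sketch.lean`: the
Rényi quasi-invariance `∫ (ψ_s∘Φ_{-r})^p ψ_s^{1-p} dL ≤ e^{pδ(N+1)}` of the canonical local Gibbs density
`ψ_s` over the kinetic window `r ∈ [0, τ(N+1)^{-1/3}]`, with ONE order `p > 1` and ONE threshold `N₀`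
serving every parameter `s ∈ [0, t₁]` of a jointly continuous positive profile family
`s ↦ (a s, θ₀ s, u₀ s)` on `[0, t₁] × 𝕋³`.

`stub_windowRenyiFamily_of_transport` is the family re-typing of the landed pointwise reduction
`KineticCurrentsWindowLDUniformLocalGibbs.stub_windowRenyi_of_transport` (crux stmt-14662): it reduces
S2, verbatim, to FAMILY KINETIC-WINDOW TRANSPORT TIGHTNESS — the registered stub S4''
`stub_windowTransport` of 14662's line `local-gibbs-entropy-ledger` re-indexed by `s`, with `N₀` uniform in
`s ∈ [0, t₁]`: for jointly continuous test families `ϑ : ℝ → 𝕋³ → ℝ`, `J : ℝ → 𝕋³ → ℝ³` there is a rate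
`s₀ > 0` with `∫ exp(s₀(|E_{ϑ_s}(Φ_r z) − E_{ϑ_s}(z)| + |M_{J_s}(Φ_r z) − M_{J_s}(z)|)) dλ^N_s ≤ e^{κ(N+1)}`
for every `κ > 0`, all large `N`, uniformly in `s ∈ [0,t₁]` and over the window
(`E_ϑ = energyObservable ϑ = Σᵢ ϑ(xᵢ)‖vᵢ‖²/2`, `M_J = momentumObservable J = Σᵢ ⟪J(xᵢ), vᵢ⟫`).
WHY TEST FAMILIES (not single test fields chosen before `s₀` as in S4''): the modular Hamiltonian of
`λ_s` is `Σᵢ g̃_s(xᵢ) + M_{u_s/θ_s} − E_{1/θ_s}`, so the port instantiates the hypothesis at the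
`s`-DEPENDENT fields `ϑ_s = 1/θ₀ s`, `J_s = u₀ s/θ₀ s` (jointly continuous because `θ₀ > 0` is); a rate
`s₀` depending on `s` through `(ϑ_s, J_s)` would not give one order `p` for the family.

Proof (the pointwise one with `s` carried along). On the hard-sphere domain
`ψ_s(Φ_r w) = ψ_s(w)·exp(ΔG_s + ΔM − ΔE)` (`stub_windowRenyi_prelim`), so after the Liouville change of
variables the Rényi integral is `E_{λ_s}[exp((p−1)(G-decrease + transport))]`; the position part is
`≤ (N+1)κ + 2C r² E(z)` with ONE quadratic modulus `C` of `g̃_s` for all `s ∈ [0,t₁]` (Heine–Cantor on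
the compact `[0,t₁] × 𝕋³`, `wrf_sub_le_quad_family`), the Gaussian energy moment is bounded through the
family bounds `θ₀ ≤ Θ`, `‖u₀‖ ≤ U` on `[0,t₁] × 𝕋³`, and the transport part is the hypothesis at
`κ = pδ`, `p = 1 + s₀/2`, whose `N₀` is uniform in `s` by assumption.
-/

noncomputable section

open MeasureTheory Set Filter
open scoped ENNReal Topology InnerProductSpace

namespace Summit.AtomisticToContinuum.HydrodynamicLimit.Theorems.KineticCurrentsLDAlongFamiliesSketch

open Literature.Analysis.FluidPDE (HardSphereFlow Config localMaxwellian canonicalDensity liouville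
  hardSphereDomain tensorPow energyObservable momentumObservable)
open Literature.MathematicalPhysics.KineticTheory (T3 V3 hsDiameter localGibbsLaw localGibbsMeasure
  localGibbsProfile)
open Literature.Analysis.FluidPDE Literature.MathematicalPhysics.KineticTheory
open Summit.AtomisticToContinuum.HydrodynamicLimit.Theorems.KineticCurrentsWindowLDUniformLocalGibbs
  (wre_sum_ratio_le wre_exists_gamma wre_exists_N0 wre_canonicalDensity_pos_of_mem stub_windowRenyi_prelim)

/-! ### Family statics: one modulus and one bound on the compact `[0, t₁] × 𝕋³` -/

/-- **Uniform quadratic modulus along a jointly continuous family.** For `g` jointly continuous on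
`ℝ × 𝕋³` and `κ > 0` there is ONE `C ≥ 0` with `g s x − g s y ≤ κ + C · dist_{𝕋³}(y, x)²` for all
`s ∈ [0, t₁]` (Heine–Cantor and boundedness on the compact `[0,t₁] × 𝕋³`; the sup-distance of
`(s, x)` and `(s, y)` is `dist x y ≤ dist_{𝕋³}`). [folklore] -/
theorem wrf_sub_le_quad_family {g : ℝ → T3 → ℝ} (hg : Continuous (Function.uncurry g)) (t₁ : ℝ)
    {κ : ℝ} (hκ : 0 < κ) :
    ∃ C : ℝ, 0 ≤ C ∧ ∀ s ∈ Icc 0 t₁, ∀ x y : T3,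
      g s x - g s y ≤ κ + C * Torus.euclidDist y x ^ 2 := by
  have hK : IsCompact (Icc (0 : ℝ) t₁ ×ˢ (univ : Set T3)) := isCompact_Icc.prod isCompact_univ
  obtain ⟨B₀, hB₀⟩ := hK.exists_bound_of_continuousOn hg.continuousOn
  obtain ⟨ℓ, hℓ, huc⟩ := Metric.uniformContinuousOn_iff.1
    (hK.uniformContinuousOn_of_continuous hg.continuousOn) κ hκ
  have hB : ∀ s ∈ Icc (0 : ℝ) t₁, ∀ z : T3, |g s z| ≤ max B₀ 0 := fun s hs z => by
    have h := hB₀ (s, z) (Set.mk_mem_prod hs (mem_univ _))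
    rw [Real.norm_eq_abs, Function.uncurry_apply_pair] at h
    exact h.trans (le_max_left _ _)
  refine ⟨2 * max B₀ 0 / ℓ ^ 2, by positivity, fun s hs x y => ?_⟩
  have hmem : ∀ z : T3, (s, z) ∈ Icc (0 : ℝ) t₁ ×ˢ (univ : Set T3) := fun z =>
    Set.mk_mem_prod hs (mem_univ _)
  have hnn : 0 ≤ 2 * max B₀ 0 / ℓ ^ 2 * Torus.euclidDist y x ^ 2 := by positivity
  by_cases hd : Torus.euclidDist y x < ℓ
  · have hxy : dist ((s, x) : ℝ × T3) (s, y) < ℓ := by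
      rw [Prod.dist_eq, dist_self, max_eq_right dist_nonneg, dist_eq_norm]
      exact (Torus.norm_sub_le_euclidDist_holds x y).trans_lt (by rwa [Torus.euclidDist_comm])
    have h := huc _ (hmem x) _ (hmem y) hxy
    rw [Real.dist_eq, Function.uncurry_apply_pair, Function.uncurry_apply_pair] at h
    linarith [(le_abs_self _).trans_lt h]
  · rw [not_lt] at hd
    have h1 : g s x - g s y ≤ 2 * max B₀ 0 := by
      linarith [(abs_le.1 (hB s hs x)).2, (abs_le.1 (hB s hs y)).1]
    have h2 : 2 * max B₀ 0 ≤ 2 * max B₀ 0 / ℓ ^ 2 * Torus.euclidDist y x ^ 2 := by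
      rw [div_mul_eq_mul_div, le_div_iff₀ (by positivity)]
      exact mul_le_mul_of_nonneg_left (pow_le_pow_left₀ hℓ.le hd 2) (by positivity)
    linarith

/-- **One upper bound along a jointly continuous family**: `f s x ≤ B` for all `s ∈ [0, t₁]`,
`x ∈ 𝕋³`, with `B > 0` (boundedness on the compact `[0,t₁] × 𝕋³`). [folklore] -/
theorem wrf_exists_forall_le_family {f : ℝ → T3 → ℝ} (hf : Continuous (Function.uncurry f))
    (t₁ : ℝ) : ∃ B : ℝ, 0 < B ∧ ∀ s ∈ Icc 0 t₁, ∀ x, f s x ≤ B := by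
  have hK : IsCompact (Icc (0 : ℝ) t₁ ×ˢ (univ : Set T3)) := isCompact_Icc.prod isCompact_univ
  obtain ⟨C, hC⟩ := hK.exists_bound_of_continuousOn hf.continuousOn
  refine ⟨max C 1, zero_lt_one.trans_le (le_max_right _ _), fun s hs x => ?_⟩
  have h := hC (s, x) (Set.mk_mem_prod hs (mem_univ _))
  rw [Real.norm_eq_abs, Function.uncurry_apply_pair] at h
  exact ((le_abs_self _).trans h).trans (le_max_left _ _)

/-! ### The reduction along the family -/

/-- **Rényi quasi-invariance of local Gibbs laws over a kinetic window, uniform along a jointly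
continuous profile family, from family kinetic-window transport tightness (helper
`stub_windowRenyiFamily_of_transport` toward the registered stub `stub_windowRenyiFamily`).**
If, along every jointly continuous positive profile family on `[0,t₁] × 𝕋³` at fixed reduced density
`0 < σ ≤ 1/2`, the kinetic-energy field tested against any jointly continuous family `ϑ_s` and the
momentum field tested against any jointly continuous family `J_s` are exponentially tight over the
kinetic window with a threshold uniform in `s` (`∃ s₀ > 0 ∀ τ ∀ κ ∀ Φ ∃ N₀ ∀ N ≥ N₀ ∀ s ∈ [0,t₁]
∀ r ∈ [0, τ(N+1)^{-1/3}]: ∫ exp(s₀(|ΔE_{ϑ_s}| + |ΔM_{J_s}|)) dλ^N_s ≤ e^{κ(N+1)}`), then the registered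
family Rényi quasi-invariance holds with `p = 1 + s₀/2`, `s₀` the rate for
`(ϑ_s, J_s) = (1/θ₀ s, u₀ s/θ₀ s)`: the position part of `log ψ_s` is paid by ONE quadratic modulus on
`[0,t₁] × 𝕋³` and the displacement–energy bound, the velocity part is exactly the window change of
`M_{u_s/θ_s} − E_{1/θ_s}`. [folklore] -/
theorem stub_windowRenyiFamily_of_transport :
    (∀ (t₁ : ℝ) (a θ₀ : ℝ → T3 → ℝ) (u₀ : ℝ → T3 → V3),
      Continuous (Function.uncurry a) → Continuous (Function.uncurry θ₀) →
      Continuous (Function.uncurry u₀) → (∀ s x, 0 < a s x) → (∀ s x, 0 < θ₀ s x) →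
      ∀ σ : ℝ, 0 < σ → σ ≤ 1 / 2 →
      ∀ (ϑ : ℝ → T3 → ℝ) (J : ℝ → T3 → V3), Continuous (Function.uncurry ϑ) →
      Continuous (Function.uncurry J) →
      ∃ s₀ : ℝ, 0 < s₀ ∧ ∀ τ : ℝ, 0 < τ → ∀ κ : ℝ, 0 < κ →
      ∀ Φ : (N : ℕ) →
        HardSphereFlow (Literature.Analysis.FluidPDE.Torus.geometry (Fin 3)) (hsDiameter σ N) (N + 1),
      ∃ N₀ : ℕ, ∀ N : ℕ, N₀ ≤ N → ∀ s ∈ Icc 0 t₁,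
      ∀ r ∈ Icc (0 : ℝ) (τ * ((N : ℝ) + 1) ^ (-(1 / 3 : ℝ))),
        ∫⁻ z, ENNReal.ofReal (Real.exp (s₀ *
            (|energyObservable (ϑ s) ((Φ N).flow r z) - energyObservable (ϑ s) z| +
              |momentumObservable (J s) ((Φ N).flow r z) - momentumObservable (J s) z|)))
          ∂(localGibbsLaw σ (a s) (u₀ s) (θ₀ s) N (Φ N)) ≤
        ENNReal.ofReal (Real.exp (κ * ((N : ℝ) + 1)))) →
    ∀ (t₁ : ℝ) (a θ₀ : ℝ → T3 → ℝ) (u₀ : ℝ → T3 → V3),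
    Continuous (Function.uncurry a) → Continuous (Function.uncurry θ₀) →
    Continuous (Function.uncurry u₀) → (∀ s x, 0 < a s x) → (∀ s x, 0 < θ₀ s x) →
    ∀ σ : ℝ, 0 < σ → σ ≤ 1 / 2 →
    ∃ p : ℝ, 1 < p ∧ ∀ τ : ℝ, 0 < τ → ∀ δ : ℝ, 0 < δ →
    ∀ Φ : (N : ℕ) →
      HardSphereFlow (Literature.Analysis.FluidPDE.Torus.geometry (Fin 3)) (hsDiameter σ N) (N + 1),
    ∃ N₀ : ℕ, ∀ N : ℕ, N₀ ≤ N → ∀ s ∈ Icc 0 t₁,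
    ∀ r ∈ Icc (0 : ℝ) (τ * ((N : ℝ) + 1) ^ (-(1 / 3 : ℝ))),
      ∫⁻ z, ENNReal.ofReal (canonicalDensity (Literature.Analysis.FluidPDE.Torus.geometry (Fin 3))
            (hsDiameter σ N) (N + 1) (localGibbsProfile (a s) (u₀ s) (θ₀ s)) ((Φ N).flow (-r) z)) ^ p *
          ENNReal.ofReal (canonicalDensity (Literature.Analysis.FluidPDE.Torus.geometry (Fin 3))
            (hsDiameter σ N) (N + 1) (localGibbsProfile (a s) (u₀ s) (θ₀ s)) z) ^ (1 - p)
        ∂(liouville (Literature.Analysis.FluidPDE.Torus.geometry (Fin 3)) (N + 1) (hsDiameter σ N)) ≤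
      ENNReal.ofReal (Real.exp (p * (δ * ((N : ℝ) + 1)))) := by
  intro hT t₁ a θ₀ u₀ ha hθ hu ha0 hθ0 σ hσ hσ2
  -- the test families of the modular Hamiltonians and the transport rate `s₀`
  have hϑc : Continuous (Function.uncurry fun s x => (θ₀ s x)⁻¹) :=
    hθ.inv₀ fun q => (hθ0 q.1 q.2).ne'
  have hJc : Continuous (Function.uncurry fun s x => (θ₀ s x)⁻¹ • u₀ s x) := hϑc.smul hu
  obtain ⟨s₀, hs0, hs⟩ := hT t₁ a θ₀ u₀ ha hθ hu ha0 hθ0 σ hσ hσ2 (fun s x => (θ₀ s x)⁻¹)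
    (fun s x => (θ₀ s x)⁻¹ • u₀ s x) hϑc hJc
  refine ⟨1 + s₀ / 2, by linarith, ?_⟩
  intro τ hτ δ hδ Φ
  set p : ℝ := 1 + s₀ / 2 with hp
  have hp0 : 0 < p := by rw [hp]; positivity
  -- the position part `g̃_s` of `log ψ_s` and ONE quadratic modulus for all `s ∈ [0,t₁]`
  set gt : ℝ → T3 → ℝ := fun s x => Real.log (a s x) +
      (-(Module.finrank ℝ V3 : ℝ) / 2) * Real.log (2 * Real.pi * θ₀ s x) -
      (θ₀ s x)⁻¹ * ‖u₀ s x‖ ^ 2 / 2 with hgt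
  have hgtc : Continuous (Function.uncurry gt) := by
    refine ((ha.log fun q => (ha0 q.1 q.2).ne').add (continuous_const.mul
      ((continuous_const.mul hθ).log fun q => ?_))).sub ((hϑc.mul (hu.norm.pow 2)).div_const 2)
    exact (mul_pos (mul_pos two_pos Real.pi_pos) (hθ0 q.1 q.2)).ne'
  set κ : ℝ := p * δ / (2 * s₀) with hκ
  have hκ0 : 0 < κ := by positivity
  obtain ⟨C, hC0, hC⟩ := wrf_sub_le_quad_family hgtc t₁ hκ0
  -- bounds of the profiles on `[0,t₁] × 𝕋³`, the energy exponent `γ`, and the thresholds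
  obtain ⟨Θ, hΘ0, hΘ'⟩ := wrf_exists_forall_le_family hθ t₁
  obtain ⟨U, _, hU'⟩ := wrf_exists_forall_le_family (f := fun s x => ‖u₀ s x‖) hu.norm t₁
  have hδ' : 0 < p * δ / 2 := by positivity
  obtain ⟨γ, hγ0, hγΘ, hK⟩ := wre_exists_gamma hΘ0 hδ' U
  obtain ⟨N₁, hN₁⟩ := wre_exists_N0 τ (s₀ * C) hγ0
  obtain ⟨N₂, hN₂⟩ := hs τ hτ (p * δ) (by positivity) Φ
  refine ⟨max N₁ N₂, fun N hN s hsI r hr => ?_⟩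
  have hN1 : N₁ ≤ N := le_of_max_le_left hN
  have hN2 : N₂ ≤ N := le_of_max_le_right hN
  -- the profiles and test fields at the parameter `s`
  have has : Continuous (a s) := ha.uncurry_left s
  have hθs : Continuous (θ₀ s) := hθ.uncurry_left s
  have hus : Continuous (u₀ s) := hu.uncurry_left s
  have ha0s : ∀ x, 0 < a s x := ha0 s
  have hθ0s : ∀ x, 0 < θ₀ s x := hθ0 s
  have hϑs : Continuous fun x => (θ₀ s x)⁻¹ := hϑc.uncurry_left s
  have hJs : Continuous fun x => (θ₀ s x)⁻¹ • u₀ s x := hJc.uncurry_left s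
  -- the Liouville measure, the density `ψ_s`, the law `λ_s`
  set L := liouville (Torus.geometry (Fin 3)) (N + 1) (hsDiameter σ N) with hL
  set ψr : Config (N + 1) (Fin 3) T3 → ℝ := fun z =>
    canonicalDensity (Torus.geometry (Fin 3)) (hsDiameter σ N) (N + 1)
      (localGibbsProfile (a s) (u₀ s) (θ₀ s)) z with hψr
  set ψ : Config (N + 1) (Fin 3) T3 → ℝ≥0∞ := fun z => ENNReal.ofReal (ψr z) with hψ
  have hlaw : localGibbsLaw σ (a s) (u₀ s) (θ₀ s) N (Φ N) = L.withDensity ψ := by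
    simp only [localGibbsLaw, particleLaw_eq, hL, hψ, hψr]
  have hψm : Measurable ψ :=
    (measurable_canonicalDensity (hsDiameter σ N) (N + 1)
      (measurable_localGibbsProfile has hθs hus)).ennreal_ofReal
  -- the two exponential weights
  set F₁ : Config (N + 1) (Fin 3) T3 → ℝ≥0∞ := fun w => ENNReal.ofReal
    (Real.exp (s₀ * (((N + 1 : ℕ) : ℝ) * κ + C * (2 * r ^ 2 * configEnergy w)))) with hF₁
  set F₂ : Config (N + 1) (Fin 3) T3 → ℝ≥0∞ := fun w => ENNReal.ofReal (Real.exp (s₀ *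
    (|energyObservable (fun x => (θ₀ s x)⁻¹) ((Φ N).flow r w) -
        energyObservable (fun x => (θ₀ s x)⁻¹) w| +
      |momentumObservable (fun x => (θ₀ s x)⁻¹ • u₀ s x) ((Φ N).flow r w) -
        momentumObservable (fun x => (θ₀ s x)⁻¹ • u₀ s x) w|))) with hF₂
  have hEm : Measurable fun z : Config (N + 1) (Fin 3) T3 => configEnergy z := by
    unfold configEnergy
    exact measurable_const.mul (Finset.measurable_sum _ fun i _ =>
      ((measurable_pi_apply i).snd.norm.pow_const 2))
  have hF₁m : Measurable F₁ :=
    (Real.measurable_exp.comp (measurable_const.mul (measurable_const.add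
      (measurable_const.mul (measurable_const.mul hEm))))).ennreal_ofReal
  have hEobs : Measurable fun z : Config (N + 1) (Fin 3) T3 =>
      energyObservable (fun x => (θ₀ s x)⁻¹) z := by
    unfold energyObservable
    exact Finset.measurable_sum _ fun i _ =>
      (hϑs.measurable.comp (measurable_pi_apply i).fst).mul
        (((measurable_pi_apply i).snd.norm.pow_const 2).div_const 2)
  have hMobs : Measurable fun z : Config (N + 1) (Fin 3) T3 =>
      momentumObservable (fun x => (θ₀ s x)⁻¹ • u₀ s x) z := by
    unfold momentumObservable
    exact Finset.measurable_sum _ fun i _ =>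
      (hJs.measurable.comp (measurable_pi_apply i).fst).inner (measurable_pi_apply i).snd
  have hF₂m : Measurable F₂ :=
    (Real.measurable_exp.comp (measurable_const.mul
      (((hEobs.comp ((Φ N).measurable_flow r)).sub hEobs).abs.add
        ((hMobs.comp ((Φ N).measurable_flow r)).sub hMobs).abs))).ennreal_ofReal
  -- Step 1: Liouville change of variables `z = Φ_r w`
  have h1 : ∫⁻ z, ψ ((Φ N).flow (-r) z) ^ p * ψ z ^ (1 - p) ∂L =
      ∫⁻ w, ψ w ^ p * ψ ((Φ N).flow r w) ^ (1 - p) ∂L := by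
    have hmeas : Measurable fun z => ψ ((Φ N).flow (-r) z) ^ p * ψ z ^ (1 - p) :=
      ((hψm.comp ((Φ N).measurable_flow (-r))).pow_const p).mul (hψm.pow_const (1 - p))
    rw [← ((Φ N).measurePreserving r).lintegral_comp hmeas]
    refine lintegral_congr_ae ?_
    filter_upwards [(Φ N).ae_mem_good] with w hw
    simp only [(Φ N).flow_neg_flow r hw]
  -- Step 2: pointwise bound on the good set
  have hpt : ∀ᵐ w ∂L, ψ w ^ p * ψ ((Φ N).flow r w) ^ (1 - p) ≤ ψ w * ((F₁ w + F₂ w) / 2) := by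
    filter_upwards [(Φ N).ae_mem_good] with w hw
    have hz : (Φ N).flow r w ∈ (Φ N).good := (Φ N).mapsTo_good r hw
    have hDw := (Φ N).good_subset hw
    have hDz := (Φ N).good_subset hz
    have hwpos : 0 < ψr w := wre_canonicalDensity_pos_of_mem has hθs hus ha0s hθ0s hσ2 hDw
    have hw0 : ψ w ≠ 0 := (ENNReal.ofReal_pos.2 hwpos).ne'
    -- the exponent: position part + transport part (the cocycle of the pointwise Prelim)
    set B₁ : ℝ := ((N + 1 : ℕ) : ℝ) * κ + C * (2 * r ^ 2 * configEnergy w) with hB₁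
    set B₂ : ℝ := |energyObservable (fun x => (θ₀ s x)⁻¹) ((Φ N).flow r w) -
          energyObservable (fun x => (θ₀ s x)⁻¹) w| +
        |momentumObservable (fun x => (θ₀ s x)⁻¹ • u₀ s x) ((Φ N).flow r w) -
          momentumObservable (fun x => (θ₀ s x)⁻¹ • u₀ s x) w| with hB₂
    set D : ℝ := ((∑ i, gt s ((Φ N).flow r w i).1) - ∑ i, gt s (w i).1) +
        (momentumObservable (fun x => (θ₀ s x)⁻¹ • u₀ s x) ((Φ N).flow r w) -
          momentumObservable (fun x => (θ₀ s x)⁻¹ • u₀ s x) w) -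
        (energyObservable (fun x => (θ₀ s x)⁻¹) ((Φ N).flow r w) -
          energyObservable (fun x => (θ₀ s x)⁻¹) w) with hD
    have hcoc : ψr ((Φ N).flow r w) = ψr w * Real.exp D := by
      simp only [hψr, hD, hgt]
      exact stub_windowRenyi_prelim (a s) (θ₀ s) (u₀ s) ha0s hθ0s σ N w ((Φ N).flow r w) hDw hDz
    have hG : ∑ i, (gt s (w i).1 - gt s ((Φ N).flow r w i).1) ≤ B₁ :=
      wre_sum_ratio_le (Φ N) hw hC0 (hC s hsI) hr.1
    have hexp : (1 - p) * D ≤ (s₀ * B₁ + s₀ * B₂) / 2 := by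
      have hX : (momentumObservable (fun x => (θ₀ s x)⁻¹ • u₀ s x) w -
            momentumObservable (fun x => (θ₀ s x)⁻¹ • u₀ s x) ((Φ N).flow r w)) -
          (energyObservable (fun x => (θ₀ s x)⁻¹) w -
            energyObservable (fun x => (θ₀ s x)⁻¹) ((Φ N).flow r w)) ≤ B₂ := by
        rw [hB₂]
        have h1 := le_abs_self (energyObservable (fun x => (θ₀ s x)⁻¹) ((Φ N).flow r w) -
          energyObservable (fun x => (θ₀ s x)⁻¹) w)
        have h2 := neg_abs_le (momentumObservable (fun x => (θ₀ s x)⁻¹ • u₀ s x) ((Φ N).flow r w) -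
          momentumObservable (fun x => (θ₀ s x)⁻¹ • u₀ s x) w)
        linarith
      have hG' : (∑ i, gt s (w i).1) - ∑ i, gt s ((Φ N).flow r w i).1 ≤ B₁ := by
        rw [← Finset.sum_sub_distrib]; exact hG
      have hsum := mul_le_mul_of_nonneg_left (add_le_add hG' hX) (by positivity : 0 ≤ s₀ / 2)
      have h1p : 1 - p = -(s₀ / 2) := by rw [hp]; ring
      rw [h1p, hD]
      linarith
    have hle : Real.exp ((1 - p) * D) ≤ (Real.exp (s₀ * B₁) + Real.exp (s₀ * B₂)) / 2 :=
      (Real.exp_le_exp.2 hexp).trans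
        (ClampedTransferCoin.RadialVirial.radialVirialTemplate_exp_half_add_le _ _)
    -- the `ℝ≥0∞` algebra `ψ(w)^p ψ(z)^{1-p} = ψ(w) e^{(1-p) D}`
    calc ψ w ^ p * ψ ((Φ N).flow r w) ^ (1 - p)
        = ENNReal.ofReal (ψr w) ^ p *
            (ENNReal.ofReal (ψr w) * ENNReal.ofReal (Real.exp D)) ^ (1 - p) := by
          simp only [hψ]
          rw [hcoc, ENNReal.ofReal_mul hwpos.le]
      _ = ENNReal.ofReal (ψr w) * ENNReal.ofReal (Real.exp D) ^ (1 - p) := by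
          rw [ENNReal.mul_rpow_of_ne_top ENNReal.ofReal_ne_top ENNReal.ofReal_ne_top, ← mul_assoc,
            ← ENNReal.rpow_add p (1 - p) hw0 ENNReal.ofReal_ne_top,
            show p + (1 - p) = 1 by ring, ENNReal.rpow_one]
      _ = ENNReal.ofReal (ψr w) * ENNReal.ofReal (Real.exp ((1 - p) * D)) := by
          rw [ENNReal.ofReal_rpow_of_pos (Real.exp_pos _), ← Real.exp_mul, mul_comm D (1 - p)]
      _ ≤ ENNReal.ofReal (ψr w) *
            ENNReal.ofReal ((Real.exp (s₀ * B₁) + Real.exp (s₀ * B₂)) / 2) :=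
          mul_le_mul_right (ENNReal.ofReal_le_ofReal hle) _
      _ = ψ w * ((F₁ w + F₂ w) / 2) := by
          simp only [hψ, hF₁, hF₂, hB₁, hB₂]
          rw [ENNReal.ofReal_div_of_pos two_pos,
            ENNReal.ofReal_add (Real.exp_nonneg _) (Real.exp_nonneg _), ENNReal.ofReal_ofNat]
  -- Step 3: the two moments under the local Gibbs law `λ_s`
  have hcN : Real.exp (s₀ * (((N + 1 : ℕ) : ℝ) * κ)) = Real.exp (p * δ / 2 * ((N : ℝ) + 1)) := by
    congr 1
    rw [hκ]
    field_simp
    push_cast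
    ring
  have hKN : (Real.exp (γ * U ^ 2) * (1 - 2 * γ * Θ) ^ (-(3 : ℝ) / 2)) ^ (N + 1) ≤
      Real.exp (p * δ / 2 * ((N : ℝ) + 1)) := by
    have hK0 : 0 ≤ Real.exp (γ * U ^ 2) * (1 - 2 * γ * Θ) ^ (-(3 : ℝ) / 2) :=
      mul_nonneg (Real.exp_nonneg _) (Real.rpow_nonneg (by linarith) _)
    refine (pow_le_pow_left₀ hK0 hK (N + 1)).trans_eq ?_
    rw [← Real.exp_nat_mul]
    congr 1
    push_cast
    ring
  have hγr : s₀ * (C * (2 * r ^ 2)) ≤ γ := by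
    have h4 : 2 * r ^ 2 ≤ 4 * (τ * ((N : ℝ) + 1) ^ (-(1 / 3 : ℝ))) ^ 2 := by
      nlinarith [pow_le_pow_left₀ hr.1 hr.2 2, sq_nonneg r]
    have := mul_le_mul_of_nonneg_left h4 (by positivity : 0 ≤ s₀ * C)
    nlinarith [hN₁ N hN1]
  have hI₁ : ∫⁻ w, F₁ w ∂(localGibbsLaw σ (a s) (u₀ s) (θ₀ s) N (Φ N)) ≤
      ENNReal.ofReal (Real.exp (p * (δ * ((N : ℝ) + 1)))) := by
    have hsplit : ∀ w, F₁ w = ENNReal.ofReal (Real.exp (s₀ * (((N + 1 : ℕ) : ℝ) * κ))) *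
        ENNReal.ofReal (Real.exp (s₀ * (C * (2 * r ^ 2)) * configEnergy w)) := by
      intro w
      simp only [hF₁]
      rw [← ENNReal.ofReal_mul (Real.exp_nonneg _), ← Real.exp_add]
      congr 2
      ring
    have hmono : ∀ w : Config (N + 1) (Fin 3) T3,
        ENNReal.ofReal (Real.exp (s₀ * (C * (2 * r ^ 2)) * configEnergy w)) ≤
        ENNReal.ofReal (Real.exp (γ * configEnergy w)) := fun w => by
      have hE0 : 0 ≤ configEnergy w := by
        show (0 : ℝ) ≤ 2⁻¹ * ∑ i, ‖(w i).2‖ ^ 2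
        exact mul_nonneg (by norm_num) (Finset.sum_nonneg fun i _ => sq_nonneg _)
      exact ENNReal.ofReal_le_ofReal (Real.exp_le_exp.2 (mul_le_mul_of_nonneg_right hγr hE0))
    have hγm : Measurable fun w : Config (N + 1) (Fin 3) T3 =>
        ENNReal.ofReal (Real.exp (s₀ * (C * (2 * r ^ 2)) * configEnergy w)) :=
      (Real.measurable_exp.comp (measurable_const.mul hEm)).ennreal_ofReal
    calc ∫⁻ w, F₁ w ∂(localGibbsLaw σ (a s) (u₀ s) (θ₀ s) N (Φ N))
        = ENNReal.ofReal (Real.exp (s₀ * (((N + 1 : ℕ) : ℝ) * κ))) *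
            ∫⁻ w, ENNReal.ofReal (Real.exp (s₀ * (C * (2 * r ^ 2)) * configEnergy w))
              ∂(localGibbsLaw σ (a s) (u₀ s) (θ₀ s) N (Φ N)) := by
          simp_rw [hsplit]
          rw [lintegral_const_mul _ hγm]
      _ ≤ ENNReal.ofReal (Real.exp (p * δ / 2 * ((N : ℝ) + 1))) *
            ENNReal.ofReal ((Real.exp (γ * U ^ 2) * (1 - 2 * γ * Θ) ^ (-(3 : ℝ) / 2)) ^ (N + 1)) := by
          rw [hcN]
          exact mul_le_mul_right ((lintegral_mono hmono).trans
            (lintegral_exp_mul_configEnergy_localGibbsLaw_le has hθs hus ha0s hθ0s hσ2 N (Φ N)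
              hγ0.le (hΘ' s hsI) (hU' s hsI) hγΘ)) _
      _ ≤ ENNReal.ofReal (Real.exp (p * δ / 2 * ((N : ℝ) + 1))) *
            ENNReal.ofReal (Real.exp (p * δ / 2 * ((N : ℝ) + 1))) :=
          mul_le_mul_right (ENNReal.ofReal_le_ofReal hKN) _
      _ = ENNReal.ofReal (Real.exp (p * (δ * ((N : ℝ) + 1)))) := by
          rw [← ENNReal.ofReal_mul (Real.exp_nonneg _), ← Real.exp_add]
          congr 2
          ring
  have hI₂ : ∫⁻ w, F₂ w ∂(localGibbsLaw σ (a s) (u₀ s) (θ₀ s) N (Φ N)) ≤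
      ENNReal.ofReal (Real.exp (p * (δ * ((N : ℝ) + 1)))) := by
    have h := hN₂ N hN2 s hsI r hr
    rwa [mul_assoc] at h
  -- Step 4: assemble
  have hF12 : Measurable fun w => F₁ w + F₂ w := hF₁m.add hF₂m
  have hF12d : Measurable fun w => (F₁ w + F₂ w) / 2 := hF12.div_const 2
  calc ∫⁻ z, ψ ((Φ N).flow (-r) z) ^ p * ψ z ^ (1 - p) ∂L
      = ∫⁻ w, ψ w ^ p * ψ ((Φ N).flow r w) ^ (1 - p) ∂L := h1
    _ ≤ ∫⁻ w, ψ w * ((F₁ w + F₂ w) / 2) ∂L := lintegral_mono_ae hpt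
    _ = ∫⁻ w, (F₁ w + F₂ w) / 2 ∂(localGibbsLaw σ (a s) (u₀ s) (θ₀ s) N (Φ N)) := by
        rw [hlaw, lintegral_withDensity_eq_lintegral_mul L hψm hF12d]
        simp only [Pi.mul_apply]
    _ = (∫⁻ w, F₁ w ∂(localGibbsLaw σ (a s) (u₀ s) (θ₀ s) N (Φ N)) +
          ∫⁻ w, F₂ w ∂(localGibbsLaw σ (a s) (u₀ s) (θ₀ s) N (Φ N))) / 2 := by
        simp only [div_eq_mul_inv]
        rw [lintegral_mul_const _ hF12, lintegral_add_left hF₁m]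
    _ ≤ (ENNReal.ofReal (Real.exp (p * (δ * ((N : ℝ) + 1)))) +
          ENNReal.ofReal (Real.exp (p * (δ * ((N : ℝ) + 1))))) / 2 :=
        ENNReal.div_le_div_right (add_le_add hI₁ hI₂) 2
    _ = ENNReal.ofReal (Real.exp (p * (δ * ((N : ℝ) + 1)))) := by
        rw [ENNReal.add_div, ENNReal.add_halves]

end Summit.AtomisticToContinuum.HydrodynamicLimit.Theorems.KineticCurrentsLDAlongFamiliesSketch

end
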